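import Mathlib
import Summits.ValiantsHypothesis.ValiantsHypothesis.Theses.RefutationDegree
import Literature.Computability.AlgebraicComplexity.DeterminantalComplexity
import Literature.Computability.AlgebraicComplexity.DeterminantalComplexityProofs
import Literature.Computability.AlgebraicComplexity.StandardFamilies
import Literature.Computability.AlgebraicComplexity.HessianAtOrigin
import Literature.Computability.AlgebraicComplexity.MignonRessayreBound
import Literature.Computability.AlgebraicComplexity.LRPencilOfMatrix
import Literature.Computability.AlgebraicComplexity.LandsbergRessayreNormalForm
import Literature.Computability.AlgebraicComplexity.AlperBogartVelascoSubspace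
import Summits.ValiantsHypothesis.ValiantsHypothesis.Theorems.RefutationDegreeBeyondHessianNsPointLemma
import Summits.ValiantsHypothesis.ValiantsHypothesis.Theorems.RefutationDegreeBeyondHessianNsKernelPlane
import Summits.ValiantsHypothesis.ValiantsHypothesis.Theorems.RefutationDegreeBeyondHessianNsStubAdjugateRowCol
import Summits.ValiantsHypothesis.ValiantsHypothesis.Theorems.RefutationDegreeBeyondHessianNsStubRenamePerPoly

/-!
# One unit past Mignon–Ressayre: `per_n = det A` of size `N` forces `n² + 2 ≤ 2N` (line `Sketch`, crux `BeyondHessianNs`, stmt-ValiantsHypothesis-5641)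

**Theorem** (`sq_add_two_le_two_mul_of_hasDetRepr_perPoly`, = the registered stub `stub_oddInfeasible`
over `ℂ`; card `kernel-pair-confinement`, `ConfinementStep`): over a field of characteristic `0`, an affine
determinantal expression of `per_n` (`n ≥ 3`) of size `N` has `n² + 2 ≤ 2N`.  Hence
`dc(per_n) ≥ ⌊n²/2⌋ + 2` for odd `n` (`not_hasDetRepr_of_odd`: no expression of size `⌊n²/2⌋ + 1`, the
infeasibility content of the crux `BeyondHessianNs` at odd `n`) and `dc(per_n) ≥ n²/2 + 1` for even `n` —
one more than Mignon–Ressayre's `n² ≤ 2 dc(per_n)` (tree `sq_le_two_mul_of_hasDetRepr_perPoly`).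

Proof: apply the point lemma (`sq_add_two_le_of_kernelPair_ne`, file `…PointLemma.lean`) to the `n²`
permuted expressions `A ∘ π_{ij}` (`per_n` is invariant, `stub_rename_perPoly`).  If all of them fail its
hypothesis, then `A₀ · adj A(y^{ij}) = 0` for every translate `y^{ij} = J - n E_{ij}` of the Mignon–Ressayre
point; `adj A(y^{ij}) ≠ 0` (corank one, `stub_adjugate_row_col`), so its non-zero column is a kernel vector of
`A₀`, hence proportional to THE kernel vector `v₀` of `A₀` (corank one at the origin too, von zur Gathen),
and also a kernel vector of `A(y^{ij})`: `A(y^{ij}) v₀ = 0` for all `i, j`.  Since `A(y) v₀` is linear in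
`y` and `Σ_{ij} y^{ij} = n(n-1) · J`, also `A(J) v₀ = 0`, so `per_n(J) = det A(J) = 0` — but
`per_n(J) = n! ≠ 0`.
-/

noncomputable section

-- `Summit.ValiantsHypothesis.ValiantsHypothesis.…` is the tree's mandated single-conjunct layout.
set_option linter.dupNamespace false

namespace Summit.ValiantsHypothesis.ValiantsHypothesis.Theorems.RefutationDegreeBeyondHessianNs

open MvPolynomial Matrix
open Literature.Computability.AlgebraicComplexity

section OddStep

variable {K : Type*} [Field K] [CharZero K]

omit [CharZero K] in
/-- `per_n(J) = n!` for the all-ones matrix. [folklore] -/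
theorem eval_one_perPoly (n : ℕ) :
    eval (fun _ => (1 : K)) (perPoly (Fin n) K) = (n.factorial : K) := by
  simp [perPoly, Matrix.permanent, Matrix.mvPolynomialX, Fintype.card_perm]

/-- **MAIN — `ConfinementStep`, one unit past Mignon–Ressayre**: an affine determinantal expression of
`per_n` (`n ≥ 3`) of size `N` over a field of characteristic `0` has `n² + 2 ≤ 2N`.  In particular
`dc(per_n) ≥ ⌊n²/2⌋ + 2` for odd `n` and `≥ n²/2 + 1` for even `n`. -/
theorem sq_add_two_le_two_mul_of_isAffineDetRepr_perPoly
    {n N : ℕ} (hn : 3 ≤ n) (A : Matrix (Fin N) (Fin N) (MvPolynomial (Fin n × Fin n) K))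
    (hA : IsAffineDetRepr (perPoly (Fin n) K) A) : n ^ 2 + 2 ≤ 2 * N := by
  classical
  obtain ⟨m, rfl⟩ : ∃ m, n = m + 3 := ⟨n - 3, by omega⟩
  obtain ⟨hdeg, hdet⟩ := hA
  by_contra hlt
  -- `N ≥ 1`
  have hN : 0 < N := by
    rcases Nat.eq_zero_or_pos N with rfl | h
    · exfalso
      have h0 := constantCoeff_perPoly K (show 1 ≤ m + 3 by omega)
      rw [← hdet, Matrix.det_isEmpty, map_one] at h0
      exact one_ne_zero h0
    · exact h
  -- the permuted expressions `A ∘ π_{ij}` are again expressions of `per`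
  let π : Fin (m + 3) → Fin (m + 3) → (Fin (m + 3) × Fin (m + 3)) → (Fin (m + 3) × Fin (m + 3)) :=
    fun i j e => (Equiv.swap 0 i e.1, Equiv.swap 0 j e.2)
  have hperm : ∀ i j, IsAffineDetRepr (perPoly (Fin (m + 3)) K) (A.map (rename (π i j))) := by
    intro i j
    refine ⟨fun a b => ?_, ?_⟩
    · rw [Matrix.map_apply]
      exact (totalDegree_rename_le _ _).trans (hdeg a b)
    · rw [← AlgHom.mapMatrix_apply, ← AlgHom.map_det, hdet]
      exact stub_rename_perPoly (Equiv.swap 0 i) (Equiv.swap 0 j)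
  have hmapmap : ∀ i j, (A.map (rename (π i j))).map (eval (mrPoint K m)) =
      A.map (eval (mrPoint K m ∘ π i j)) := by
    intro i j
    rw [Matrix.map_map]
    congr 1
    funext p
    simp only [Function.comp_apply, eval_rename]
  have hconst : ∀ i j, constPart (A.map (rename (π i j))) = constPart A := by
    intro i j
    ext a b
    simp [constPart_apply, constantCoeff_rename]
  -- every permuted expression fails the point lemma's hypothesis
  have hfail : ∀ i j, constPart A * (A.map (eval (mrPoint K m ∘ π i j))).adjugate = 0 := by
    intro i j
    by_contra h
    apply hlt
    have key := sq_add_two_le_of_kernelPair_ne (A.map (rename (π i j))) (hperm i j) (by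
      right
      rwa [hmapmap, hconst])
    exact key
  -- the constant part `A₀`, its kernel vector `v₀` (unique up to scale: von zur Gathen)
  have hA₀det : (constPart A).det = 0 := by
    rw [det_constPart, hdet, constantCoeff_perPoly K (by omega)]
  have hA₀rank : (constPart A).rank = N - 1 := by
    have hge := AlperBogartVelasco.le_rank_map_eval_add_one (two_ne_zero : (2 : K) ≠ 0)
      (by omega : 3 ≤ m + 3) A hdet 0
    rw [← constPart_eq_map_eval_zero] at hge
    have hlt' := Matrix.rank_lt_card_of_det_eq_zero hA₀det
    rw [Fintype.card_fin] at hlt'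
    omega
  obtain ⟨v₀, hv₀, hAv₀⟩ := Matrix.exists_mulVec_eq_zero_iff.mpr hA₀det
  have huniq : ∀ u, constPart A *ᵥ u = 0 → ∃ μ : K, μ • v₀ = u := by
    have hker : Module.finrank K (LinearMap.ker (constPart A).mulVecLin) = 1 := by
      have h1 := LinearMap.finrank_range_add_finrank_ker (constPart A).mulVecLin
      have h2 : Module.finrank K (LinearMap.range (constPart A).mulVecLin) = (constPart A).rank :=
        rfl
      rw [h2, hA₀rank] at h1
      simp only [Module.finrank_fintype_fun_eq_card, Fintype.card_fin] at h1
      omega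
    have hv₀mem : v₀ ∈ LinearMap.ker (constPart A).mulVecLin := hAv₀
    have hne : (⟨v₀, hv₀mem⟩ : LinearMap.ker (constPart A).mulVecLin) ≠ 0 := by
      intro h
      exact hv₀ (congrArg Subtype.val h)
    intro u hu
    obtain ⟨μ, hμ⟩ := (finrank_eq_one_iff_of_nonzero' _ hne).mp hker ⟨u, hu⟩
    exact ⟨μ, congrArg Subtype.val hμ⟩
  -- each translate `y^{ij} = y₀ ∘ π_{ij}` satisfies `A(y^{ij}) v₀ = 0`
  have hyv : ∀ i j, A.map (eval (mrPoint K m ∘ π i j)) *ᵥ v₀ = 0 := by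
    intro i j
    have h2 := hfail i j
    have hMydet : (A.map (eval (mrPoint K m ∘ π i j))).det = 0 := by
      rw [← RingHom.mapMatrix_apply, ← RingHom.map_det, hdet, ← eval_rename,
        stub_rename_perPoly, eval_mrPoint_perPoly]
    have hMyrank : (A.map (eval (mrPoint K m ∘ π i j))).rank = Fintype.card (Fin N) - 1 := by
      have hge := AlperBogartVelasco.le_rank_map_eval_add_one (two_ne_zero : (2 : K) ≠ 0)
        (by omega : 3 ≤ m + 3) A hdet (mrPoint K m ∘ π i j)
      have hlt' := Matrix.rank_lt_card_of_det_eq_zero hMydet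
      rw [Fintype.card_fin] at hlt' ⊢
      omega
    obtain ⟨V, U, i₀, hV, hU, hVMU⟩ := exists_mul_mul_eq_lamMatrix _ hMyrank
      (by rw [Fintype.card_fin]; exact hN)
    obtain ⟨hadj, -, -⟩ := stub_adjugate_row_col _ (constPart A) V U i₀ hV hU hVMU
    obtain ⟨p, q, hpq⟩ : ∃ p q, (A.map (eval (mrPoint K m ∘ π i j))).adjugate p q ≠ 0 := by
      by_contra h
      push Not at h
      exact hadj (Matrix.ext fun p q => by rw [h p q, Matrix.zero_apply])
    -- the column `q` of `adj A(y)` is a non-zero kernel vector of `A₀` and of `A(y)`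
    set w : Fin N → K := fun a => (A.map (eval (mrPoint K m ∘ π i j))).adjugate a q with hw
    have hA₀w : constPart A *ᵥ w = 0 := by
      funext a
      have := congrFun (congrFun h2 a) q
      rw [Matrix.mul_apply, Matrix.zero_apply] at this
      simpa [Matrix.mulVec, dotProduct, hw] using this
    obtain ⟨μ, hμ⟩ := huniq w hA₀w
    have hμ0 : μ ≠ 0 := by
      rintro rfl
      apply hpq
      have := congrFun hμ p
      simp only [zero_smul, Pi.zero_apply] at this
      rw [hw] at this
      exact this.symm
    have hMyw : A.map (eval (mrPoint K m ∘ π i j)) *ᵥ w = 0 := by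
      funext a
      have := congrFun (congrFun (Matrix.mul_adjugate (A.map (eval (mrPoint K m ∘ π i j)))) a) q
      rw [hMydet, zero_smul, Matrix.mul_apply, Matrix.zero_apply] at this
      simpa [Matrix.mulVec, dotProduct, hw] using this
    rw [← hμ, Matrix.mulVec_smul] at hMyw
    exact (smul_eq_zero.mp hMyw).resolve_left hμ0
  -- linear structure: `A(y) v₀ = Bm y`
  set Bm : Matrix (Fin N) (Fin (m + 3) × Fin (m + 3)) K :=
    Matrix.of fun a w => (LRPencil.coeffMat A w *ᵥ v₀) a with hBm
  have hAy : ∀ y, A.map (eval y) *ᵥ v₀ = Bm *ᵥ y := by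
    intro y
    rw [LRPencil.map_eval_eq A hdeg y, Matrix.add_mulVec, hAv₀, zero_add, sum_smul_mulVec_eq]
  -- the translates average to the all-ones matrix
  have hsum : ∑ i : Fin (m + 3), ∑ j : Fin (m + 3), (mrPoint K m ∘ π i j) =
      ((((m + 3 : ℕ) : K)) * (((m + 3 : ℕ) : K) - 1)) • (fun _ => (1 : K)) := by
    funext e
    simp only [Finset.sum_apply, Function.comp_apply, mrPoint_apply, Pi.smul_apply, smul_eq_mul,
      mul_one, π]
    have hite : ∀ i j : Fin (m + 3),
        (if Equiv.swap 0 i e.1 = 0 ∧ Equiv.swap 0 j e.2 = 0 then -((m : K) + 2) else 1) =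
          1 + (if i = e.1 then (if j = e.2 then (-((m : K) + 2) - 1) else 0) else 0) := by
      intro i j
      have h1 : Equiv.swap 0 i e.1 = 0 ↔ e.1 = i := by
        rw [Equiv.swap_apply_eq_iff, Equiv.swap_apply_left]
      have h2 : Equiv.swap 0 j e.2 = 0 ↔ e.2 = j := by
        rw [Equiv.swap_apply_eq_iff, Equiv.swap_apply_left]
      simp only [h1, h2]
      by_cases hi : i = e.1
      · by_cases hj : j = e.2
        · simp only [hi, hj, and_self, if_true]
          ring
        · have hj' : ¬ e.2 = j := fun h => hj h.symm
          simp [hi, hj, hj']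
      · have hi' : ¬ e.1 = i := fun h => hi h.symm
        simp [hi, hi']
    simp_rw [hite]
    have inner : ∀ i : Fin (m + 3), ∑ j : Fin (m + 3),
        (1 + (if i = e.1 then (if j = e.2 then (-((m : K) + 2) - 1) else 0) else 0)) =
          ((m + 3 : ℕ) : K) + (if i = e.1 then (-((m : K) + 2) - 1) else 0) := by
      intro i
      rw [Finset.sum_add_distrib, Finset.sum_const, Finset.card_univ, Fintype.card_fin,
        nsmul_eq_mul, mul_one]
      congr 1
      split_ifs with hi
      · rw [Finset.sum_ite_eq' Finset.univ e.2, if_pos (Finset.mem_univ _)]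
      · simp
    simp_rw [inner]
    rw [Finset.sum_add_distrib, Finset.sum_const, Finset.card_univ, Fintype.card_fin,
      nsmul_eq_mul, Finset.sum_ite_eq' Finset.univ e.1, if_pos (Finset.mem_univ _)]
    push_cast
    ring
  have hJ : Bm *ᵥ (fun _ => (1 : K)) = 0 := by
    have hne : (((m + 3 : ℕ) : K)) * (((m + 3 : ℕ) : K) - 1) ≠ 0 := by
      refine mul_ne_zero (by exact_mod_cast Nat.succ_ne_zero (m + 2)) ?_
      have : (((m + 3 : ℕ) : K) - 1) = ((m + 2 : ℕ) : K) := by push_cast; ring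
      rw [this]
      exact_mod_cast Nat.succ_ne_zero (m + 1)
    have h0 : Bm *ᵥ (∑ i : Fin (m + 3), ∑ j : Fin (m + 3), (mrPoint K m ∘ π i j)) = 0 := by
      rw [Matrix.mulVec_sum]
      refine Finset.sum_eq_zero fun i _ => ?_
      rw [Matrix.mulVec_sum]
      refine Finset.sum_eq_zero fun j _ => ?_
      rw [← hAy]
      exact hyv i j
    rw [hsum, Matrix.mulVec_smul] at h0
    exact (smul_eq_zero.mp h0).resolve_left hne
  -- `per(J) = 0`, contradicting `per(J) = n!`
  have hdetJ : (A.map (eval (fun _ => (1 : K)))).det = 0 :=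
    Matrix.exists_mulVec_eq_zero_iff.mp ⟨v₀, hv₀, by rw [hAy]; exact hJ⟩
  rw [← RingHom.mapMatrix_apply, ← RingHom.map_det, hdet, eval_one_perPoly] at hdetJ
  exact Nat.factorial_ne_zero (m + 3) (by exact_mod_cast hdetJ)

/-- `HasDetRepr` form of the main theorem. -/
theorem sq_add_two_le_two_mul_of_hasDetRepr_perPoly {n N : ℕ} (hn : 3 ≤ n)
    (h : HasDetRepr (perPoly (Fin n) K) N) : n ^ 2 + 2 ≤ 2 * N := by
  obtain ⟨A, hA⟩ := h
  exact sq_add_two_le_two_mul_of_isAffineDetRepr_perPoly hn A hA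

/-- **`dc` form**: `n² + 2 ≤ 2 · dc(per_n)` for `n ≥ 3` over a field of characteristic `0` (the infimum
`dc` is attained, tree `hasDetRepr_determinantalComplexity_holds`). One more than Mignon–Ressayre's
`n² ≤ 2 · dc(per_n)` (`sq_le_two_mul_determinantalComplexity_perPoly_complex_holds`). -/
theorem sq_add_two_le_two_mul_determinantalComplexity_perPoly {n : ℕ} (hn : 3 ≤ n) :
    n ^ 2 + 2 ≤ 2 * determinantalComplexity (perPoly (Fin n) K) :=
  sq_add_two_le_two_mul_of_hasDetRepr_perPoly hn (hasDetRepr_determinantalComplexity_holds _)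

end OddStep

/-- **The registered stub `stub_oddInfeasible`** (skeleton `Cruxes/BeyondHessianNs/Lines/Sketch.lean`):
`ConfinementStep` over `ℂ` — `3 ≤ n → HasDetRepr per_n m → n² + 2 ≤ 2m`. -/
theorem stub_oddInfeasible : ∀ (n m : ℕ), 3 ≤ n →
    Literature.Computability.AlgebraicComplexity.HasDetRepr
      (Literature.Computability.AlgebraicComplexity.perPoly (Fin n) ℂ) m → n ^ 2 + 2 ≤ 2 * m :=
  fun _ _ hn h => sq_add_two_le_two_mul_of_hasDetRepr_perPoly hn h

/-- The infeasibility content of the crux at ODD `n`: no affine determinantal expression of size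
`⌊n²/2⌋ + 1` (`2 (⌊n²/2⌋ + 1) = n² + 1 < n² + 2`). -/
theorem not_hasDetRepr_of_odd {n : ℕ} (hn : 3 ≤ n) (ho : Odd n) :
    ¬ HasDetRepr (perPoly (Fin n) ℂ) (n ^ 2 / 2 + 1) := by
  intro hrep
  have h := sq_add_two_le_two_mul_of_hasDetRepr_perPoly hn hrep
  obtain ⟨k, rfl⟩ := ho
  have hsq : (2 * k + 1) ^ 2 = 2 * (2 * k ^ 2 + 2 * k) + 1 := by ring
  rw [hsq] at h
  omega


end Summit.ValiantsHypothesis.ValiantsHypothesis.Theorems.RefutationDegreeBeyondHessianNs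

end
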